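import Literature.NumberTheory.EllipticCurves.BurungaleSkinner2023.Curve14a1TwistsCertificate
import HarnessLib

/-!
# Burungale–Skinner 2023, Thms. 2.9 / 3.2 / 3.5 at `p = 3`: the curve-side hypotheses from an
# integer model with a rational `3`-torsion point (proofs only; the engine behind Example (E3))

A. Burungale, C. Skinner, Proc. AMS Ser. B 10 (2023), Example (E3) (p. 22): "The elliptic curves
26.a2, 34.a3, 35.a2, 38.a2, 44.a2, 50.a2, 106c2 also have rational `3`-torsion points and satisfy the
hypotheses of Theorem 2.8." The CURVE-SIDE hypotheses of Thm. 2.8 — which are exactly the hypotheses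
of Thms. 2.9 (p. 21), 3.2 (p. 25) and 3.5 (p. 27) — are, for a curve with a rational point `T` of
order `3` ("take `Φ` to be the subgroup generated by this point. In particular, `ϕ = 1`", p. 17):
`3 ∤ N`; a prime `ℓ₀ ∣ N` with `r_{ℓ₀} = 1`; and `ℓ₀ ≡ −1 (mod 3)` if `ℓ₀ ∈ A`. This file reduces them,
once and for all, to DECIDABLE statements about an integer model `W₀ = [a₁,a₂,a₃,a₄,a₆]` that is a
global minimal equation:

* `exists_line_of_nsmul_toGeomPoints_eq_zero` — a rational point `T ≠ O` with `p·T̄ = O` spans a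
  line `Φ = ⟨T̄⟩ ≤ E[p]` of order `p` with TRIVIAL `Γ_ℚ`-action (`ϕ = 1`; general prime `p`);
* `not_dvd_conductorNorm_baseChange_int` / `dvd_conductorNorm_baseChange_int` — `3 ∤ Δ(W₀) ⇒ 3 ∤ N`
  and `ℓ₀ ∣ Δ(W₀) ⇒ ℓ₀ ∣ N` (Ogg–Saito support statement, tree `conductorExponent_eq_zero_of_not_dvd_Δ`
  / `conductorExponent_ne_zero_of_dvd_Δ`; NO semistability needed, so additive curves such as
  (E2) `20.a3` or (E3) `44.a2`, `50.a2` are covered without computing their conductor exponents);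
* `hasMultiplicativeReductionAtPrime_baseChange_int_of_dvd_of_not_dvd` (`p ∣ Δ`, `p ∤ c₄`: the LOCAL
  form of the semistable lemma of `Curve14a1TwistsCertificate`) and
  `not_hasMultiplicativeReductionAtPrime_baseChange_int_of_dvd_of_dvd` (`p ∣ Δ`, `p ∣ c₄`: additive,
  hence not multiplicative) — the two halves of Silverman VII.5.1 used to settle "`ℓ₀ ∈ A`";
* `addv_imp_of_not_dvd_c₄` — "`ℓ₀ ≡ −1 mod 3` if `ℓ₀ ∈ A`" is void when `ℓ₀ ∤ c₄`;
* **the engine** `posProportion_twists_of_intModel` (Thm. 2.9), `infinitelyMany_twists_of_intModel`,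
  `infinitelyMany_twists_pPartBSD_of_intModel` (Thm. 3.2),
  `infinitelyMany_evenTwists_pPartBSD_rankZero_of_intModel` (Thm. 3.5): from `3 ∤ Δ(W₀)`,
  `ℓ₀ ∣ Δ(W₀)`, `r_{ℓ₀} = 1`, (`ℓ₀ ∣ c₄(W₀) → ℓ₀ ≡ 2 mod 3`) and a rational point `T ≠ O` with
  `3·T̄ = O`, the printed conclusions for `W₀ ⊗ ℚ` MODULO the named facts `thm29_…`, `thm32_…`,
  `thm35_…` by name.

Theorems only; no definitions, no new facts. The instances (E2), (E3) are filed separately.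

References: [BurungaleSkinner2023] Thms. 2.8/2.9 (pp. 20–21), 3.2 (p. 25), 3.5 (p. 27), remark after
Lemma 2.3 (p. 17), Examples (E1)–(E3) (p. 22); [SilvermanAEC2009] VII.1 Rem. 1.1, VII.5 Prop. 5.1,
VIII.§1; [BombieriGubler2006] 12.5.9; [Silverman1994] IV.10.2.
-/

noncomputable section

open scoped Classical

open NumberField IsDedekindDomain IsDedekindDomain.HeightOneSpectrum WeierstrassCurve Polynomial
  Literature.NumberTheory.EllipticCurves Literature.NumberTheory.EllipticCurves.Rank1Residual
  Literature.NumberTheory.QuadraticFields.Quadratic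

namespace Literature.NumberTheory.EllipticCurves.BurungaleSkinner2023

/-! ### §1 A rational point of prime order spans a line with `ϕ = 1` -/

section Line

variable {W : WeierstrassCurve ℚ} {p : ℕ} [hp : Fact p.Prime]

/-- **"Take `Φ` to be the subgroup generated by this point. In particular, `ϕ = 1`."** A rational
point `T ≠ O` whose image `T̄ ∈ E(ℚ̄)` satisfies `p·T̄ = O` spans a subgroup `Φ = ⟨T̄⟩ ≤ E[p]` with
`#Φ = p` on which `Γ_ℚ` acts TRIVIALLY (Galois descent `E(ℚ) ⊆ E(ℚ̄)^{Γ_ℚ}`, tree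
`smul_toGeomPoints`). [cite: BurungaleSkinner2023, remark after Lemma 2.3 (p. 17)] -/
theorem exists_line_of_nsmul_toGeomPoints_eq_zero (T : W.toAffine.Point) (hT0 : T ≠ 0)
    (hT : p • toGeomPoints W T = 0) :
    ∃ Φ : AddSubgroup (geomTorsion W (p : ℤ)),
      Nat.card Φ = p ∧ ∀ σ : Field.absoluteGaloisGroup ℚ, ∀ P ∈ Φ, σ • P = P := by
  have hne : toGeomPoints W T ≠ 0 := fun h =>
    hT0 (toGeomPoints_injective W (h.trans (map_zero _).symm))
  have hmem : toGeomPoints W T ∈ geomTorsion W (p : ℤ) := by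
    rw [mem_torsionBy_iff, natCast_zsmul]
    exact hT
  set Tt : geomTorsion W (p : ℤ) := ⟨toGeomPoints W T, hmem⟩ with hTt
  have hfix : ∀ σ : Field.absoluteGaloisGroup ℚ, σ • Tt = Tt := fun σ =>
    Subtype.ext (smul_toGeomPoints W σ T)
  have hord : addOrderOf Tt = p := by
    rw [← AddSubgroup.addOrderOf_coe]
    exact addOrderOf_eq_prime hT hne
  refine ⟨AddSubgroup.zmultiples Tt, ?_, ?_⟩
  · rw [Nat.card_zmultiples, hord]
  · intro σ P hP
    obtain ⟨k, rfl⟩ := AddSubgroup.mem_zmultiples_iff.mp hP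
    rw [smul_comm σ k Tt, hfix]

/-- The line of a rational `p`-torsion point is a RATIONAL line (`Γ_ℚ`-stable of order `p`) whose
character is even and unramified at `p` — the disjunct "even and unramified at `3`" of Thms.
2.8/2.9/3.2/3.5. [cite: BurungaleSkinner2023, remark after Lemma 2.3 (p. 17)] -/
theorem isRationalLine_and_even_of_forall_smul_eq {Φ : AddSubgroup (geomTorsion W (p : ℤ))}
    (hcard : Nat.card Φ = p) (htriv : ∀ σ : Field.absoluteGaloisGroup ℚ, ∀ P ∈ Φ, σ • P = P) :
    IsRationalLine W p Φ ∧
      ((LineEven W p Φ ∧ LineUnramifiedAt W p Φ) ∨ (LineOdd W p Φ ∧ ¬ LineUnramifiedAt W p Φ)) :=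
  ⟨⟨hcard, fun σ P hP => by rw [htriv σ P hP]; exact hP⟩,
    Or.inl ⟨lineEven_of_forall_smul_eq htriv, lineUnramifiedAt_of_forall_smul_eq htriv⟩⟩

end Line

/-! ### §2 Integer models: local reduction criteria and the support of the conductor -/

section IntModel

variable (W₀ : WeierstrassCurve ℤ)

/-- **`p ∣ Δ(W₀)`, `p ∤ c₄(W₀) ⇒` multiplicative reduction at `p`** (the LOCAL form: `c₄` a `p`-unit,
`v_p(Δ) > 0`; no global coprimality of `Δ`, `c₄` needed). [cite: SilvermanAEC2009, VII.5 Prop. 5.1(b)] -/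
theorem hasMultiplicativeReductionAtPrime_baseChange_int_of_dvd_of_not_dvd
    [(W₀.baseChange ℚ).IsElliptic] {p : ℕ} [hp : Fact p.Prime] (hΔ : (p : ℤ) ∣ W₀.Δ)
    (hc₄ : ¬ (p : ℤ) ∣ W₀.c₄) : (W₀.baseChange ℚ).HasMultiplicativeReductionAtPrime p := by
  set v := (Rat.HeightOneSpectrum.primesEquiv (R := ℤ)).symm ⟨p, hp.out⟩ with hv
  have hgen : Rat.HeightOneSpectrum.natGenerator v = p := Rat.natGenerator_primesEquiv_symm ⟨p, hp.out⟩
  refine ((W₀.baseChange ℚ).hasMultiplicativeReductionAtPrime_iff_hasMultiplicativeReductionAt_holds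
    ⟨p, hp.out⟩).mpr (hasMultiplicativeReductionAt_of_valuation_c₄_eq_one
      (isIntegralAt_baseChange v W₀) ?_ ?_)
  · rw [baseChange_int_c₄, Rat.valuation_intCast_eq_one_iff, hgen]
    exact hc₄
  · rw [baseChange_int_Δ, Rat.valuation_intCast_lt_one_iff, hgen]
    exact hΔ

/-- **`p ∣ Δ(W₀)`, `p ∣ c₄(W₀)`, `W₀` minimal at `p` (`p¹² ∤ Δ`) `⇒` NOT multiplicative at `p`**
(additive reduction: `v_p(c₄) > 0` contradicts the multiplicative criterion `v_p(c₄) = 0` of a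
minimal equation). [cite: SilvermanAEC2009, VII.5 Prop. 5.1(b),(c)] -/
theorem not_hasMultiplicativeReductionAtPrime_baseChange_int_of_dvd_of_dvd
    [(W₀.baseChange ℚ).IsElliptic] {p : ℕ} [hp : Fact p.Prime] (hmin : ¬ (p : ℤ) ^ 12 ∣ W₀.Δ)
    (hc₄ : (p : ℤ) ∣ W₀.c₄) : ¬ (W₀.baseChange ℚ).HasMultiplicativeReductionAtPrime p := by
  set v := (Rat.HeightOneSpectrum.primesEquiv (R := ℤ)).symm ⟨p, hp.out⟩ with hv
  have hgen : Rat.HeightOneSpectrum.natGenerator v = p := Rat.natGenerator_primesEquiv_symm ⟨p, hp.out⟩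
  intro hm
  have hm' := ((W₀.baseChange ℚ).hasMultiplicativeReductionAtPrime_iff_hasMultiplicativeReductionAt_holds
    ⟨p, hp.out⟩).mp hm
  have hminv : (W₀.baseChange ℚ).IsMinimalAt v :=
    isMinimalAt_baseChange_int_of_not_pow_dvd_Δ (by rw [hgen]; exact hmin)
  have h1 := ((hasMultiplicativeReductionAt_iff_of_isMinimalAt hminv).mp hm').2
  rw [baseChange_int_c₄, Rat.valuation_intCast_eq_one_iff, hgen] at h1
  exact h1 hc₄

/-- **"`ℓ₀ ≡ −1 mod 3` if `ℓ₀ ∈ A`" is void when `ℓ₀ ∤ c₄(W₀)`**: then `W₀ ⊗ ℚ` has good (`ℓ₀ ∤ Δ`) or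
multiplicative (`ℓ₀ ∣ Δ`) reduction at `ℓ₀`, so `ℓ₀ ∉ A`. [cite: SilvermanAEC2009, VII.5 Prop. 5.1(a),(b)] -/
theorem addv_imp_of_not_dvd_c₄ [(W₀.baseChange ℚ).IsElliptic] {ℓ₀ : ℕ} [Fact ℓ₀.Prime]
    (hc₄ : ¬ (ℓ₀ : ℤ) ∣ W₀.c₄) (Q : Prop) : Addv (W₀.baseChange ℚ) ℓ₀ → Q := by
  intro hA
  by_cases hΔ : (ℓ₀ : ℤ) ∣ W₀.Δ
  · exact absurd (hasMultiplicativeReductionAtPrime_baseChange_int_of_dvd_of_not_dvd W₀ hΔ hc₄) hA.2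
  · exact absurd (hasGoodReductionAtPrime_baseChange_int_of_not_dvd W₀ hΔ) hA.1

/-- **`p ∤ Δ(W₀) ⇒ p ∤ N`** for an integer model minimal at `p` (`f_p = 0` at a prime of good
reduction; the conductor and the minimal discriminant have the same support).
[cite: BombieriGubler2006, 12.5.9(a)] -/
theorem not_dvd_conductorNorm_baseChange_int [(W₀.baseChange ℚ).IsElliptic] {p : ℕ} (hp : p.Prime)
    (hmin : ¬ (p : ℤ) ^ 12 ∣ W₀.Δ) (h : ¬ (p : ℤ) ∣ W₀.Δ) :
    ¬ p ∣ (W₀.baseChange ℚ).conductorNorm ℤ := by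
  intro hdvd
  have hpos : 0 < ((W₀.baseChange ℚ).conductorNorm ℤ).factorization p :=
    hp.factorization_pos_of_dvd ((W₀.baseChange ℚ).conductorNorm_pos_holds).ne' hdvd
  rw [show p = ((⟨p, hp⟩ : Nat.Primes) : ℕ) from rfl, factorization_conductorNorm_primesEquiv_symm] at hpos
  set v := (Rat.HeightOneSpectrum.primesEquiv (R := ℤ)).symm ⟨p, hp⟩ with hv
  have hgen : Rat.HeightOneSpectrum.natGenerator v = p := Rat.natGenerator_primesEquiv_symm ⟨p, hp⟩
  have hminv : (W₀.baseChange ℚ).IsMinimalAt v :=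
    isMinimalAt_baseChange_int_of_not_pow_dvd_Δ (by rw [hgen]; exact hmin)
  have h0 := conductorExponent_eq_zero_of_not_dvd_Δ hminv (by rw [hgen]; exact h)
  omega

/-- **`p ∣ Δ(W₀) ⇒ p ∣ N`** for an integer model minimal at `p` (`f_p ≠ 0` at a prime of bad
reduction — multiplicative OR additive). [cite: BombieriGubler2006, 12.5.9(d)] -/
theorem dvd_conductorNorm_baseChange_int [(W₀.baseChange ℚ).IsElliptic] {p : ℕ} (hp : p.Prime)
    (hmin : ¬ (p : ℤ) ^ 12 ∣ W₀.Δ) (h : (p : ℤ) ∣ W₀.Δ) :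
    p ∣ (W₀.baseChange ℚ).conductorNorm ℤ := by
  by_contra hndvd
  have h0 : ((W₀.baseChange ℚ).conductorNorm ℤ).factorization p = 0 :=
    Nat.factorization_eq_zero_of_not_dvd hndvd
  rw [show p = ((⟨p, hp⟩ : Nat.Primes) : ℕ) from rfl, factorization_conductorNorm_primesEquiv_symm] at h0
  set v := (Rat.HeightOneSpectrum.primesEquiv (R := ℤ)).symm ⟨p, hp⟩ with hv
  have hgen : Rat.HeightOneSpectrum.natGenerator v = p := Rat.natGenerator_primesEquiv_symm ⟨p, hp⟩
  have hminv : (W₀.baseChange ℚ).IsMinimalAt v :=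
    isMinimalAt_baseChange_int_of_not_pow_dvd_Δ (by rw [hgen]; exact hmin)
  exact conductorExponent_ne_zero_of_dvd_Δ hminv (by rw [hgen]; exact h) h0

/-- **Good reduction off `Δ(W₀)`**, prime-indexed with explicit exceptions: if every prime divisor
of `Δ(W₀)` lies in a list `S`, then `W₀ ⊗ ℚ` has good reduction at every prime `ℓ ∉ S` — the
"(c)–(e) are vacuous outside the bad primes" bookkeeping of the certificates.
[cite: SilvermanAEC2009, VII.5 Prop. 5.1(a)] -/
theorem hasGoodReductionAtPrime_baseChange_int_of_forall_dvd [(W₀.baseChange ℚ).IsElliptic]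
    (S : Finset ℕ) (hS : ∀ q : ℕ, q.Prime → (q : ℤ) ∣ W₀.Δ → q ∈ S) {ℓ : ℕ} [hℓ : Fact ℓ.Prime]
    (h : ℓ ∉ S) : (W₀.baseChange ℚ).HasGoodReductionAtPrime ℓ :=
  hasGoodReductionAtPrime_baseChange_int_of_not_dvd W₀ fun hd => h (hS ℓ hℓ.out hd)

end IntModel

/-! ### §3 The engine: Thms. 2.9 / 3.2 / 3.5 for `W₀ ⊗ ℚ` from decidable data -/

section Engine

variable (W₀ : WeierstrassCurve ℤ) [hE : (W₀.baseChange ℚ).IsElliptic]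
  [hmin : (W₀.baseChange ℚ).IsGloballyMinimal] {ℓ₀ : ℕ} [hℓ₀ : Fact ℓ₀.Prime]

omit hmin in
/-- **The curve-side hypotheses of Thms. 2.8 / 2.9 / 3.2 / 3.5 from an integer model.** For a global
minimal integer equation `W₀` (`3¹² ∤ Δ`, `ℓ₀¹² ∤ Δ` suffice here) with `3 ∤ Δ(W₀)` (so `3 ∤ N`),
`ℓ₀ ∣ Δ(W₀)` (so `ℓ₀ ∣ N`), `r_{ℓ₀} = 1`, `ℓ₀ ∣ c₄(W₀) → ℓ₀ ≡ 2 (mod 3)` (the additive proviso) and a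
rational point `T ≠ O` with `3·T̄ = O`: the six hypotheses of `thm29_…`/`thm32_…`/`thm35_…` hold for
`Φ = ⟨T̄⟩`. [cite: BurungaleSkinner2023, Thm. 2.9 (hypotheses, p. 21) and remark after Lemma 2.3 (p. 17)] -/
theorem curveSide_of_intModel (h3 : ¬ (3 : ℤ) ∣ W₀.Δ) (h3min : ¬ (3 : ℤ) ^ 12 ∣ W₀.Δ)
    (hℓmin : ¬ (ℓ₀ : ℤ) ^ 12 ∣ W₀.Δ) (hℓ : (ℓ₀ : ℤ) ∣ W₀.Δ)
    (hA : (ℓ₀ : ℤ) ∣ W₀.c₄ → ℓ₀ % 3 = 2) (T : (W₀.baseChange ℚ).toAffine.Point) (hT0 : T ≠ 0)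
    (hT3 : (3 : ℕ) • toGeomPoints (W₀.baseChange ℚ) T = 0) :
    ∃ Φ : AddSubgroup (geomTorsion (W₀.baseChange ℚ) ((3 : ℕ) : ℤ)),
      ¬ 3 ∣ (W₀.baseChange ℚ).conductorNorm ℤ ∧ IsRationalLine (W₀.baseChange ℚ) 3 Φ ∧
      ((LineEven (W₀.baseChange ℚ) 3 Φ ∧ LineUnramifiedAt (W₀.baseChange ℚ) 3 Φ) ∨
        (LineOdd (W₀.baseChange ℚ) 3 Φ ∧ ¬ LineUnramifiedAt (W₀.baseChange ℚ) 3 Φ)) ∧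
      ℓ₀ ∣ (W₀.baseChange ℚ).conductorNorm ℤ ∧ (Addv (W₀.baseChange ℚ) ℓ₀ → ℓ₀ % 3 = 2) ∧
      (∀ σ : Field.absoluteGaloisGroup ℚ, ∀ P ∈ Φ, σ • P = P) := by
  obtain ⟨Φ, hcard, htriv⟩ := exists_line_of_nsmul_toGeomPoints_eq_zero (p := 3) T hT0 hT3
  obtain ⟨hrat, hpar⟩ := isRationalLine_and_even_of_forall_smul_eq (p := 3) hcard htriv
  refine ⟨Φ, not_dvd_conductorNorm_baseChange_int W₀ Nat.prime_three h3min h3, hrat, hpar,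
    dvd_conductorNorm_baseChange_int W₀ hℓ₀.out hℓmin hℓ, ?_, htriv⟩
  by_cases hc : (ℓ₀ : ℤ) ∣ W₀.c₄
  · exact fun _ => hA hc
  · exact addv_imp_of_not_dvd_c₄ W₀ hc _

/-- **Thm. 2.9 for `W₀ ⊗ ℚ`, modulo the named fact `thm29_posProportion_twists_rankOne_nondegenerate`**:
from the decidable data of `curveSide_of_intModel`, for a positive proportion of discriminants `d`
of imaginary quadratic fields `TwistConclusion (W₀ ⊗ ℚ) 3 d` — `rank E^{(d)}(ℚ) = ord_{s=1}
L(E^{(d)}, s) = 1`, `λ = 1`, and the `3`-adic height pairing on every global minimal model of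
`E^{(d)}` is NON-DEGENERATE. [cite: BurungaleSkinner2023, Thm. 2.9 (p. 21)] -/
theorem posProportion_twists_of_intModel (h3 : ¬ (3 : ℤ) ∣ W₀.Δ) (h3min : ¬ (3 : ℤ) ^ 12 ∣ W₀.Δ)
    (hℓmin : ¬ (ℓ₀ : ℤ) ^ 12 ∣ W₀.Δ) (hℓ : (ℓ₀ : ℤ) ∣ W₀.Δ) (hr : numPrimesAbove 3 ℓ₀ = 1)
    (hA : (ℓ₀ : ℤ) ∣ W₀.c₄ → ℓ₀ % 3 = 2) (T : (W₀.baseChange ℚ).toAffine.Point) (hT0 : T ≠ 0)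
    (hT3 : (3 : ℕ) • toGeomPoints (W₀.baseChange ℚ) T = 0)
    (h : thm29_posProportion_twists_rankOne_nondegenerate) :
    OddQuadraticCharPosProportion fun d ↦ TwistConclusion (W₀.baseChange ℚ) 3 d := by
  obtain ⟨Φ, hN, hrat, hpar, hℓN, hAv, -⟩ :=
    curveSide_of_intModel W₀ h3 h3min hℓmin hℓ hA T hT0 hT3
  exact h (W₀.baseChange ℚ) Φ ℓ₀ hN hrat hpar hℓN hr hAv

/-- **Infinitely many rank-one twists with non-degenerate `3`-adic height**, modulo Thm. 2.9 by name
(positive proportion ⇒ infinitely many, `OddQuadraticCharPosProportion.infinite`).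
[cite: BurungaleSkinner2023, Thm. 2.9 (p. 21)] -/
theorem infinitelyMany_twists_of_intModel (h3 : ¬ (3 : ℤ) ∣ W₀.Δ) (h3min : ¬ (3 : ℤ) ^ 12 ∣ W₀.Δ)
    (hℓmin : ¬ (ℓ₀ : ℤ) ^ 12 ∣ W₀.Δ) (hℓ : (ℓ₀ : ℤ) ∣ W₀.Δ) (hr : numPrimesAbove 3 ℓ₀ = 1)
    (hA : (ℓ₀ : ℤ) ∣ W₀.c₄ → ℓ₀ % 3 = 2) (T : (W₀.baseChange ℚ).toAffine.Point) (hT0 : T ≠ 0)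
    (hT3 : (3 : ℕ) • toGeomPoints (W₀.baseChange ℚ) T = 0)
    (h : thm29_posProportion_twists_rankOne_nondegenerate) :
    {d : ℤ | IsOddQuadraticCharDiscr d ∧ TwistConclusion (W₀.baseChange ℚ) 3 d}.Infinite :=
  (posProportion_twists_of_intModel W₀ h3 h3min hℓmin hℓ hr hA T hT0 hT3 h).infinite

/-- **Thm. 3.2 for `W₀ ⊗ ℚ`, modulo the named fact `thm32_posProportion_twists_pPartBSD`**: infinitely
many discriminants `d` of imaginary quadratic fields with `ord_{s=1} L(E^{(d)}, s) = 1` and the printed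
`3`-part of the rank-one BSD formula for every global minimal model of `E^{(d)}`.
[cite: BurungaleSkinner2023, Thm. 3.2 (p. 25)] -/
theorem infinitelyMany_twists_pPartBSD_of_intModel (h3 : ¬ (3 : ℤ) ∣ W₀.Δ)
    (h3min : ¬ (3 : ℤ) ^ 12 ∣ W₀.Δ) (hℓmin : ¬ (ℓ₀ : ℤ) ^ 12 ∣ W₀.Δ) (hℓ : (ℓ₀ : ℤ) ∣ W₀.Δ)
    (hr : numPrimesAbove 3 ℓ₀ = 1) (hA : (ℓ₀ : ℤ) ∣ W₀.c₄ → ℓ₀ % 3 = 2)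
    (T : (W₀.baseChange ℚ).toAffine.Point) (hT0 : T ≠ 0)
    (hT3 : (3 : ℕ) • toGeomPoints (W₀.baseChange ℚ) T = 0)
    (h : thm32_posProportion_twists_pPartBSD) :
    {d : ℤ | IsOddQuadraticCharDiscr d ∧
      (((W₀.baseChange ℚ).quadraticTwist (d : ℚ)).analyticRank = 1 ∧
        ∀ (W' : WeierstrassCurve ℚ) [W'.IsElliptic] [W'.IsGloballyMinimal] (C : VariableChange ℚ),
          C • (W₀.baseChange ℚ).quadraticTwist (d : ℚ) = W' → PPartRankOnePrintShape W' 3)}.Infinite := by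
  obtain ⟨Φ, hN, hrat, hpar, hℓN, hAv, -⟩ :=
    curveSide_of_intModel W₀ h3 h3min hℓmin hℓ hA T hT0 hT3
  exact thm32_infinitelyMany_twists_pPartBSD h (W₀.baseChange ℚ) Φ ℓ₀ hN hrat hpar hℓN hr hAv

/-- **Thm. 3.5 for `W₀ ⊗ ℚ`, modulo the named fact `thm35_posProportion_evenTwists_pPartBSD_rankZero`**:
infinitely many discriminants `d` of REAL quadratic fields with `L(E^{(d)}, 1) ≠ 0` and the printed
`3`-part of the rank-zero BSD formula for every global minimal model of `E^{(d)}`.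
[cite: BurungaleSkinner2023, Thm. 3.5 (p. 27)] -/
theorem infinitelyMany_evenTwists_pPartBSD_rankZero_of_intModel (h3 : ¬ (3 : ℤ) ∣ W₀.Δ)
    (h3min : ¬ (3 : ℤ) ^ 12 ∣ W₀.Δ) (hℓmin : ¬ (ℓ₀ : ℤ) ^ 12 ∣ W₀.Δ) (hℓ : (ℓ₀ : ℤ) ∣ W₀.Δ)
    (hr : numPrimesAbove 3 ℓ₀ = 1) (hA : (ℓ₀ : ℤ) ∣ W₀.c₄ → ℓ₀ % 3 = 2)
    (T : (W₀.baseChange ℚ).toAffine.Point) (hT0 : T ≠ 0)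
    (hT3 : (3 : ℕ) • toGeomPoints (W₀.baseChange ℚ) T = 0)
    (h : thm35_posProportion_evenTwists_pPartBSD_rankZero) :
    {d : ℤ | IsEvenQuadraticCharDiscr d ∧
      (((W₀.baseChange ℚ).quadraticTwist (d : ℚ)).entireLFunction 1 ≠ 0 ∧
        ∀ (W' : WeierstrassCurve ℚ) [W'.IsElliptic] [W'.IsGloballyMinimal] (C : VariableChange ℚ),
          C • (W₀.baseChange ℚ).quadraticTwist (d : ℚ) = W' → PPartRankZeroPrintShape W' 3)}.Infinite := by
  obtain ⟨Φ, hN, hrat, hpar, hℓN, hAv, -⟩ :=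
    curveSide_of_intModel W₀ h3 h3min hℓmin hℓ hA T hT0 hT3
  exact thm35_infinitelyMany_evenTwists_pPartBSD_rankZero h (W₀.baseChange ℚ) Φ ℓ₀ hN hrat hpar hℓN
    hr hAv

end Engine

/-! ### §4 The values `r_ℓ` at `p = 3` used by (E3) -/

/-- `r₅ = 1` at `p = 3` (`(5² − 1)/3 = 8`, `3 ∤ 8`): the auxiliary prime `ℓ₀ = 5` of `35.a`/`50.a`.
[cite: BurungaleSkinner2023, §2.1.1 (p. 16) (definition of r_ℓ)] -/
theorem numPrimesAbove_three_five : numPrimesAbove 3 5 = 1 := by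
  rw [numPrimesAbove, show (5 ^ (3 - 1) - 1) / 3 = 8 by norm_num,
    padicValNat.eq_zero_of_not_dvd (by norm_num), pow_zero]

/-- `r₁₃ = 1` at `p = 3` (`(13² − 1)/3 = 56`, `3 ∤ 56`): the auxiliary prime `ℓ₀ = 13` of `26.a`.
[cite: BurungaleSkinner2023, §2.1.1 (p. 16) (definition of r_ℓ)] -/
theorem numPrimesAbove_three_thirteen : numPrimesAbove 3 13 = 1 := by
  rw [numPrimesAbove, show (13 ^ (3 - 1) - 1) / 3 = 56 by norm_num,
    padicValNat.eq_zero_of_not_dvd (by norm_num), pow_zero]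

/-- `r₁₁ = 1` at `p = 3` (`(11² − 1)/3 = 40`, `3 ∤ 40`): the auxiliary prime `ℓ₀ = 11` of `44.a`.
[cite: BurungaleSkinner2023, §2.1.1 (p. 16) (definition of r_ℓ)] -/
theorem numPrimesAbove_three_eleven : numPrimesAbove 3 11 = 1 := by
  rw [numPrimesAbove, show (11 ^ (3 - 1) - 1) / 3 = 40 by norm_num,
    padicValNat.eq_zero_of_not_dvd (by norm_num), pow_zero]

/-- `r₁₇ = 3` at `p = 3` (`(17² − 1)/3 = 96 = 3 · 32`): `17` is NOT an admissible `ℓ₀` for `34.a`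
(only `ℓ₀ = 2` is). [cite: BurungaleSkinner2023, §2.1.1 (p. 16) (definition of r_ℓ)] -/
theorem numPrimesAbove_three_seventeen : numPrimesAbove 3 17 = 3 := by
  rw [numPrimesAbove, show (17 ^ (3 - 1) - 1) / 3 = 3 * 32 by norm_num,
    padicValNat.mul (by norm_num) (by norm_num), padicValNat.self (by norm_num),
    padicValNat.eq_zero_of_not_dvd (by norm_num)]
  norm_num

end Literature.NumberTheory.EllipticCurves.BurungaleSkinner2023

end
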